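import Summits.QuantumFields.BalabanUV.Beta.GAN24.Push4LegTelescope
import Summits.QuantumFields.BalabanUV.Beta.GAN24.TransportMarginal
import Summits.QuantumFields.BalabanUV.Beta.GAN24.RespStepBm
import Summits.QuantumFields.BalabanUV.Beta.GAN24.ContactKernelCells

/-!
# `BalabanUV.Beta.GAN24.Push4LegTelescopeComb` — binder row G-an2-4 ∕ (CONV-C), CT-W (the row owner gan24-p1-g22's «CT-W DESIGN v0» §2 (R-CT) ∕ §3 CT-W1
# `SandwichLegTelescope`): THE COMB INSTANCE OF THE LEG-WISE TELESCOPE — for the DRESSED (`Ĝ_j = coDressKBmAt ρ Lc K̃_j`) and the UNDRESSED (`K̃_j = KStepUnit Lc j`)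
# one-step maps `lin4 c · Lc`, `[P^E − P^B](m, k+1)` ON THE ff-VALUED `LocStencil₂` CLASS IS `(−c)^{k+1} •` ONE BOND-SYMMETRISED SUM OF FOUR PUSHES, EACH WITH EXACTLY ONE
# LEG = (±) THE PURE GAUGE `dz λ_{m,k}` OF CT-2 and the other three legs FULL composite response families (dressed `legChain (respStepBmSeq ρ Lc) m k` or undressed
# `respStep (Lc^m) (Lc^(m+k+1))`).

NOT IN PRINT; OUR BOOKKEEPING (G-an2-4 formalisation swarm, leaf prover `b2b-balaban-gan24-formalise-leaf-03`, gen 57; the instance layer between `Push4LegTelescope` (CT-W1,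
leg form; filed on leaf-06 g42's «GO leaf-03», journal `CLAIMS.log` l.37611, where this follow-on is suggested) and the row owner's CT-W2 cells; module name PROVISIONAL — the row owner
may rename ∕ re-home ∕ re-cut).  HONEST FRAMING (cell contract, verbatim): «discharging `BetaPertH` makes Bałaban's UV stability UNCONDITIONAL — a real constructive-QFT result; it is
NOT the continuum limit and NOT the Clay problem.»  HONEST DEPENDENCY (verbatim): «continuum YM on T⁴ ⇐ BetaPertH ∧ nine spine estimates (0/9 proved); BetaPertH ⇐ (D1) ∧ (D4) ∧
CAP+tail; G-an2-4 gates asym, D1 and NE2/3/4.»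

WHAT ([folklore] bookkeeping BY NAME; 0 `def`, 0 cited facts, 0 `def … : Prop`, 0 sorry):
* §1 (generic `d`, ANY kernel sequence `K : ℕ → MKer`, each `K j` decaying at some positive rate, blocking `N ≥ 1`) — the generic-`K` twin of leaf-10's `TransportMarginal` §1 (typed there
  for `K̃_j` only): on the class «ff-valued ∧ `LocStencil₂` at a positive rate» the one-step map `lin4 c (K j) N` IS `(−c) •` the bond-symmetrised push through `(rowM (K j) N, colH (K j) N)`
  (leaf-17's `Push4Sym.mmRead_sandwich_vsym_eq_push₄`), the class is preserved, and
  **`transport_lin4_eq_smul_symB_push₄`**: `transport (j ↦ lin4 c (K j) N) m (k+1) Y = (−c)^{k+1} • symB (push₄ (legChain (j ↦ rowM (K j) N) m k) (legChain (j ↦ colH (K j) N) m k) Y)`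
  (`AffineUnroll.transport_smul_eq` + leaf-17's `Push4Iter.transport_symPush`).
* §2 sign bookkeeping: `legChain (j ↦ −l j) m k = (−1)^{k+1} • legChain l m k` (`RespStepSemigroup.legComp_neg_neg` iterated).
* §3 THE COMB DICTIONARY (`Ĝ_j := coDressKBmAt ρ Lc (KStepUnit Lc j)`, in-block root): `(j ↦ colH Ĝ_j Lc) = respStepBmSeq ρ Lc`, `(j ↦ rowM Ĝ_j Lc) = (j ↦ −respStepBmSeq ρ Lc j)` (leaf-01's
  `RespStepBm.colH∕rowM_coDressKBmAt_KStepUnit`), hence the DRESSED chains are `legChain (respStepBmSeq ρ Lc) m k` and `(−1)^{k+1} •` it; the UNDRESSED chains are `respStep (Lc^m) (Lc^(m+k+1))`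
  and `(−1)^{k+1} •` it (leaf-10's `legChain_colH` + §2); and the DIFFERENCE of the dressed and undressed chain is the PURE GAUGE of CT-2, leaf-01's
  `ContactKernelCells.legChain_respStepBmSeq_sub_respStep`: `legChain (respStepBmSeq ρ Lc) m k − respStep (Lc^m) (Lc^(m+k+1)) = (μ z κ u ↦ dz (λ_{m,k} μ z) κ u)`,
  `λ_{m,k} μ z = Psi ρ Lc m k (delta1 μ z) − bmGaugeAt ρ (respStep (Lc^m) (Lc^(m+k+1)) μ z) Lc`.
* §4 **THE INSTANCE** `transport_lin4_coDress_sub_eq` (generic `d`; `∀ j, ∃ C m, 0 < m ∧ Decays K̃_j C m` — the K-slot's uniform decay gives it —; in-block root; `Y` ff-valued and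
  `LocStencil₂` at a positive rate): `transport (j ↦ lin4 c Ĝ_j Lc) m (k+1) Y − transport (j ↦ lin4 c K̃_j Lc) m (k+1) Y = (−c)^{k+1} • symB (push₄W (ε•G) R R R Y + push₄W (ε•B) G R R Y
  + push₄W (ε•B) B G R Y + push₄W (ε•B) B B G Y)` with `R = legChain (respStepBmSeq ρ Lc) m k` (dressed column chain), `B = respStep (Lc^m) (Lc^(m+k+1))` (undressed), `G = R − B = dz λ_{m,k}`
  (the gauge family), `ε = (−1)^{k+1}` (the row legs' sign) — EVERY TERM HAS EXACTLY ONE PURE-GAUGE LEG, the other three are full composite response families with the tree's envelopes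
  (`DressedLegEnvelope.exists_legChain_envelope` ∕ (N1) `RespStepDecay`), and NO operator bound on a dressed transport appears.  SCOPE: the ff-valued class — a general first member
  (e.g. the border part `cB • vh₂S` of the source, which is fm∕mf-valued) takes ONE general step first (`TransportMarginal.step_shape ∕ step_isFF`; for the dressed-vs-undressed first step
  leaf-06's `LinT2CoDressedStep.lin4_comb_coDressKBmAt` gives `lin4 c Ĝ Y − lin4 c K̃ Y = lin4 c K̃ (𝔇Y − Y)` by `Lin4Additive`), after which this theorem applies from the next level.
Asserts NO shape or rate of an2's ∕ Bałaban's tables; NO estimate; discharges NOTHING of «T2Shape» ∕ «T2Drift» ∕ (hW, hWall); 0 wall binders; NEVER «G-an2-4 closed» as (CONV-C); NOT D1, NOT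
BetaPertH, NOT continuum, NOT Clay; not in print — our bookkeeping.
-/

noncomputable section

open Finset
open scoped BigOperators
open Literature.MathematicalPhysics.QuantumFieldTheory
open Literature.MathematicalPhysics.QuantumFieldTheory.Balaban1983to89
open Literature.MathematicalPhysics.QuantumFieldTheory.Balaban1983to89.Beta
open B12Sec2to5 (l1 l1_nonneg)
open ExpKernelCalculus (MKer Decays comp Zl Zl_nonneg)
open AffineAveraging (Form1 Site box toSite dz)
open KKTFluctuationKernel (delta1)
open OneStepResolventKernel (Fib LocStencil)
open OneStepKernelFamily (colH)
open BalabanCompositeJets (LocStencil₂ respStep)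
open BalabanStepW2 (locStencil₂_smul')
open Summit.QuantumFields.BalabanUV.Beta.AxialProjectorBlockMean (bmGaugeAt)
open Summit.QuantumFields.BalabanUV.Beta.AxialDressingRooted (coDressKBmAt decays_coDressKBmAt)
open Summit.QuantumFields.BalabanUV.Beta.GAN24.CombesThomas (KStepUnit)
open Summit.QuantumFields.BalabanUV.Beta.GAN24.T2RecursionAffine (lin4 lin4_apply vsym)
open Summit.QuantumFields.BalabanUV.Beta.GAN24.Push4 (rowM push₄ IsFF isFF_push₄ isFF_mmRead)
open Summit.QuantumFields.BalabanUV.Beta.GAN24.Push4Bounds (LegDecay legDecay_colH legDecay_rowM)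
open Summit.QuantumFields.BalabanUV.Beta.GAN24.Push4LocStencil (locStencil₂_push₄ cPush)
open Summit.QuantumFields.BalabanUV.Beta.GAN24.Push4Iter (BiTab LegFam symB symB_apply legChain legChain_zero legChain_succ locStencil₂_symB push₄_lin
  transport_symPush)
open Summit.QuantumFields.BalabanUV.Beta.GAN24.Push4Sym (mmRead_sandwich_vsym_eq_push₄)
open Summit.QuantumFields.BalabanUV.Beta.GAN24.AffineUnroll (transport transport_succ transport_mem transport_smul_eq)
open Summit.QuantumFields.BalabanUV.Beta.GAN24.TransportMarginal (transport_congr_mem isFF_neg_smul isFF_smul isFF_symB legChain_colH)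
open Summit.QuantumFields.BalabanUV.Beta.GAN24.RespStepSemigroup (legComp_neg_right rowM_KStepUnit_eq colH_KStepUnit)
open Summit.QuantumFields.BalabanUV.Beta.GAN24.RespStepBmDecompPsi (legComp_smul_left)
open Summit.QuantumFields.BalabanUV.Beta.GAN24.RespStepBm (colH_coDressKBmAt_KStepUnit rowM_coDressKBmAt_KStepUnit legDecay_literal_legs)
open Summit.QuantumFields.BalabanUV.Beta.GAN24.RespStepBmDecompExact (respStepBmSeq respStepBmSeq_apply)
open Summit.QuantumFields.BalabanUV.Beta.GAN24.RespStepBmDecompPsi (Psi)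
open Summit.QuantumFields.BalabanUV.Beta.GAN24.ContactKernelCells (legChain_respStepBmSeq_sub_respStep)
open Summit.QuantumFields.BalabanUV.Beta.GAN24.Push4LegTelescope (push₄W push₄_sub_push₄_of_legDecay symB_sub)

namespace Summit.QuantumFields.BalabanUV.Beta.GAN24.Push4LegTelescopeComb

variable {d : ℕ}

/-! ## §1 Generic kernel sequence: the transport of `lin4 c (K j) N` on the ff-valued `LocStencil₂` class is `(−c)^k •` the transport of the symmetrised pushes -/

section Generic

variable {N : ℕ} {K : ℕ → MKer (d + 1) (Fib d)} {c : ℝ}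

/-- [folklore] The output of `lin4` is ff-valued, whatever the table (`Push4.isFF_mmRead`). -/
theorem isFF_lin4 (c : ℝ) (K : MKer (d + 1) (Fib d)) (N : ℕ) (X : BiTab d) (κ : Fin (d + 1)) (u : Fin (d + 1) → ℤ) (κ' : Fin (d + 1))
    (u' : Fin (d + 1) → ℤ) : IsFF (lin4 c K N X κ u κ' u') := by
  rw [lin4_apply]
  exact isFF_neg_smul c (isFF_mmRead _ _)

/-- [folklore] **ON ff-VALUED `LocStencil₂` TABLES `lin4 c K N` IS `(−c) •` THE BOND-SYMMETRISED PUSH** through `(rowM K N, colH K N)` — ANY decaying kernel `K`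
(leaf-17's `Push4Sym.mmRead_sandwich_vsym_eq_push₄`; leaf-10's `TransportMarginal.step_eq_symPush` is the `K̃_j` instance). -/
theorem lin4_eq_smul_symB_push₄ {K : MKer (d + 1) (Fib d)} {CK mK : ℝ} (hK : Decays K CK mK) (hmK : 0 < mK) (c : ℝ) (N : ℕ) {Z : BiTab d}
    (hZff : ∀ κ u κ' u', IsFF (Z κ u κ' u')) {C δ : ℝ} (hZ : LocStencil₂ Z C δ) (hδ : 0 < δ) :
    lin4 c K N Z = (-c) • symB (push₄ (rowM K N) (colH K N) Z) := by
  funext κ u κ' u'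
  rw [lin4_apply, show vsym K N Z κ u κ' u' = (1 / 2 : ℝ) • (SecondOrderResponse.vertex2OfK K N Z κ u κ' u' +
      SecondOrderResponse.vertex2OfK K N Z κ' u' κ u) from rfl, mmRead_sandwich_vsym_eq_push₄ hK hmK hZff hZ hδ]
  simp only [Pi.smul_apply, symB_apply, neg_smul]

/-- [folklore] **THE BOND-SYMMETRISED PUSH THROUGH THE LEGS OF A DECAYING KERNEL PRESERVES THE CLASS** «ff-valued ∧ `LocStencil₂` at a positive rate» (blocking `N ≥ 1`;
`isFF_push₄`, `locStencil₂_push₄`, `locStencil₂_symB`). -/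
theorem symB_push₄_mem (hN : 1 ≤ N) {K : MKer (d + 1) (Fib d)} {CK mK : ℝ} (hK : Decays K CK mK) (hmK : 0 < mK) {Z : BiTab d}
    (hZ : (∀ κ u κ' u', IsFF (Z κ u κ' u')) ∧ ∃ C δ : ℝ, 0 < δ ∧ LocStencil₂ Z C δ) :
    (∀ κ u κ' u', IsFF (symB (push₄ (rowM K N) (colH K N) Z) κ u κ' u')) ∧
      ∃ C δ : ℝ, 0 < δ ∧ LocStencil₂ (symB (push₄ (rowM K N) (colH K N) Z)) C δ := by
  obtain ⟨-, C, δ, hδ, hZl⟩ := hZ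
  have hNpos : (0 : ℝ) < (N : ℝ) := by exact_mod_cast hN
  refine ⟨fun κ u κ' u' => isFF_symB (fun μ y ν y' => isFF_push₄ _ _ Z μ y ν y') κ u κ' u', ?_⟩
  obtain ⟨δ', hδ'0, hδ'δ, hδ'm⟩ : ∃ δ' : ℝ, 0 < δ' ∧ δ' ≤ δ ∧ 3 * δ' < mK := by
    refine ⟨min δ (mK / 4), lt_min hδ (by positivity), min_le_left _ _, ?_⟩
    have := min_le_right δ (mK / 4); linarith
  have hP := locStencil₂_push₄ (legDecay_rowM (N := N) hK) (legDecay_colH (N := N) hK) (hZl.mono hδ'δ) hδ'0.le hδ'm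
  exact ⟨_, _, by positivity, locStencil₂_symB hP (by positivity)⟩

/-- [folklore] **THE BOND-SYMMETRISED PUSH IS HOMOGENEOUS** on `LocStencil₂` tables at a positive rate (leaf-17's `Push4Iter.push₄_lin` with `Y₁ = Y₂`). -/
theorem symB_push₄_smul {K : MKer (d + 1) (Fib d)} {CK mK : ℝ} (hK : Decays K CK mK) (hmK : 0 < mK) (N : ℕ) (s : ℝ) {Z : BiTab d}
    {C δ : ℝ} (hZ : LocStencil₂ Z C δ) (hδ : 0 < δ) :
    symB (push₄ (rowM K N) (colH K N) (s • Z)) = s • symB (push₄ (rowM K N) (colH K N) Z) := by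
  have hl := legDecay_rowM (N := N) hK
  have hr := legDecay_colH (N := N) hK
  have e : s • Z = (s / 2) • (Z + Z) := by rw [smul_add, ← add_smul, add_halves]
  have hom : ∀ μ y ν y', push₄ (rowM K N) (colH K N) (s • Z) μ y ν y' = s • push₄ (rowM K N) (colH K N) Z μ y ν y' := by
    intro μ y ν y'
    rw [e, push₄_lin hl hr hmK hZ hZ hδ (s / 2) μ y ν y']
    module
  funext μ y ν y'
  rw [symB_apply, hom, hom]
  simp only [Pi.smul_apply, symB_apply]
  module

/-- [folklore] **ON THE CLASS, THE TRANSPORT OF `lin4 c (K j) N` IS `(−c)^k •` THE TRANSPORT OF THE SYMMETRISED PUSHES** — any kernel sequence with each `K j` decaying at a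
positive rate, blocking `N ≥ 1` (`transport_congr_mem` + `AffineUnroll.transport_smul_eq`; the `K̃_j` instance is leaf-10's `transport_eq_smul_symPush`). -/
theorem transport_lin4_eq_smul_transport_symB (hN : 1 ≤ N) (hK : ∀ j, ∃ C m : ℝ, 0 < m ∧ Decays (K j) C m) (c : ℝ) (m k : ℕ) {Y : BiTab d}
    (hY : (∀ κ u κ' u', IsFF (Y κ u κ' u')) ∧ ∃ C δ : ℝ, 0 < δ ∧ LocStencil₂ Y C δ) :
    transport (fun j => lin4 c (K j) N) m k Y
      = (-c) ^ k • transport (fun j Z => symB (push₄ (rowM (K j) N) (colH (K j) N) Z)) m k Y := by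
  have hBP : ∀ j (Z : BiTab d), ((∀ κ u κ' u', IsFF (Z κ u κ' u')) ∧ ∃ C δ : ℝ, 0 < δ ∧ LocStencil₂ Z C δ) →
      (∀ κ u κ' u', IsFF (symB (push₄ (rowM (K j) N) (colH (K j) N) Z) κ u κ' u')) ∧
        ∃ C δ : ℝ, 0 < δ ∧ LocStencil₂ (symB (push₄ (rowM (K j) N) (colH (K j) N) Z)) C δ := by
    intro j Z hZ
    obtain ⟨CK, mK, hmK, hKj⟩ := hK j
    exact symB_push₄_mem hN hKj hmK hZ
  have hBP' : ∀ j (Z : BiTab d), ((∀ κ u κ' u', IsFF (Z κ u κ' u')) ∧ ∃ C δ : ℝ, 0 < δ ∧ LocStencil₂ Z C δ) →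
      (∀ κ u κ' u', IsFF (((-c) • symB (push₄ (rowM (K j) N) (colH (K j) N) Z)) κ u κ' u')) ∧
        ∃ C δ : ℝ, 0 < δ ∧ LocStencil₂ ((-c) • symB (push₄ (rowM (K j) N) (colH (K j) N) Z)) C δ := by
    intro j Z hZ
    obtain ⟨hff, C, δ, hδ, hl⟩ := hBP j Z hZ
    exact ⟨fun κ u κ' u' => isFF_smul (-c) (hff κ u κ' u'), |(-c)| * C, δ, hδ, locStencil₂_smul' (-c) hl⟩
  have hAB : ∀ j (Z : BiTab d), ((∀ κ u κ' u', IsFF (Z κ u κ' u')) ∧ ∃ C δ : ℝ, 0 < δ ∧ LocStencil₂ Z C δ) →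
      lin4 c (K j) N Z = (-c) • symB (push₄ (rowM (K j) N) (colH (K j) N) Z) := by
    intro j Z hZ
    obtain ⟨hff, C, δ, hδ, hl⟩ := hZ
    obtain ⟨CK, mK, hmK, hKj⟩ := hK j
    exact lin4_eq_smul_symB_push₄ hKj hmK c N hff hl hδ
  have hsmul : ∀ j (r : ℝ) (Z : BiTab d), ((∀ κ u κ' u', IsFF (Z κ u κ' u')) ∧ ∃ C δ : ℝ, 0 < δ ∧ LocStencil₂ Z C δ) →
      symB (push₄ (rowM (K j) N) (colH (K j) N) (r • Z)) = r • symB (push₄ (rowM (K j) N) (colH (K j) N) Z) := by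
    intro j r Z hZ
    obtain ⟨-, C, δ, hδ, hl⟩ := hZ
    obtain ⟨CK, mK, hmK, hKj⟩ := hK j
    exact symB_push₄_smul hKj hmK N r hl hδ
  rw [transport_congr_mem hBP' hAB m hY k]
  exact transport_smul_eq (P := fun Z : BiTab d => (∀ κ u κ' u', IsFF (Z κ u κ' u')) ∧ ∃ C δ : ℝ, 0 < δ ∧ LocStencil₂ Z C δ)
    hBP hsmul (-c) m k hY

/-- [folklore] **THE `(k+1)`-FOLD TRANSPORT OF `lin4 c (K j) N` ON THE CLASS IS `(−c)^{k+1} •` ONE BOND-SYMMETRISED PUSH THROUGH THE LEG CHAINS** (§1 + leaf-17's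
`Push4Iter.transport_symPush`): `transport (j ↦ lin4 c (K j) N) m (k+1) Y = (−c)^{k+1} • symB (push₄ (legChain (j ↦ rowM (K j) N) m k) (legChain (j ↦ colH (K j) N) m k) Y)`. -/
theorem transport_lin4_eq_smul_symB_push₄ (hN : 1 ≤ N) (hK : ∀ j, ∃ C m : ℝ, 0 < m ∧ Decays (K j) C m) (c : ℝ) (m k : ℕ) {Y : BiTab d}
    (hY : (∀ κ u κ' u', IsFF (Y κ u κ' u')) ∧ ∃ C δ : ℝ, 0 < δ ∧ LocStencil₂ Y C δ) :
    transport (fun j => lin4 c (K j) N) m (k + 1) Y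
      = (-c) ^ (k + 1) • symB (push₄ (legChain (fun j => rowM (K j) N) m k) (legChain (fun j => colH (K j) N) m k) Y) := by
  have hl : ∀ j, ∃ C m : ℝ, 0 < m ∧ LegDecay (rowM (K j) N) N C m := fun j => by
    obtain ⟨C, m, hm, hKj⟩ := hK j; exact ⟨C, m, hm, legDecay_rowM hKj⟩
  have hr : ∀ j, ∃ C m : ℝ, 0 < m ∧ LegDecay (colH (K j) N) N C m := fun j => by
    obtain ⟨C, m, hm, hKj⟩ := hK j; exact ⟨C, m, hm, legDecay_colH hKj⟩
  rw [transport_lin4_eq_smul_transport_symB hN hK c m (k + 1) hY, transport_symPush hN hl hr hY.2 m k]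

end Generic

/-! ## §2 Sign bookkeeping for the row legs -/

/-- [folklore] **A SIGN ON EVERY LEVEL's LEG COMES OUT OF THE CHAIN AS `(−1)^{k+1}`**: `legChain (j ↦ −l j) m k = (−1)^{k+1} • legChain l m k`
(`legComp (−a) (−b) = legComp a b`, leaf-12's `RespStepSemigroup.legComp_neg_neg` ∕ `legComp_neg_left`). -/
theorem legChain_neg (l : ℕ → LegFam d) (m : ℕ) : ∀ k, legChain (fun j => -l j) m k = (-1 : ℝ) ^ (k + 1) • legChain l m k
  | 0 => by simp only [legChain_zero, zero_add, pow_one, neg_one_smul]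
  | k + 1 => by
    simp only [legChain_succ]
    rw [legChain_neg l m k, legComp_smul_left, legComp_neg_right, smul_neg, ← neg_smul, pow_succ _ (k + 1), mul_neg_one]

/-! ## §3 The comb dictionary: dressed and undressed leg sequences and their chains -/

section Comb

variable {Lc : ℕ} [NeZero Lc]

/-- [folklore] **THE DRESSED COLUMN ∕ TABLE LEG SEQUENCE IS `respStepBmSeq`**: `(j ↦ colH (coDressKBmAt ρ Lc K̃_j) Lc) = respStepBmSeq ρ Lc` (leaf-01's
`RespStepBm.colH_coDressKBmAt_KStepUnit`, levelwise). -/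
theorem colH_coDress_seq (ρ : Fin (d + 1) → ℤ) :
    (fun j => colH (coDressKBmAt ρ Lc (KStepUnit (d := d) Lc j)) Lc) = respStepBmSeq (d := d) ρ Lc := by
  funext j
  rw [colH_coDressKBmAt_KStepUnit, respStepBmSeq_apply]

/-- [folklore] **THE DRESSED ROW LEG SEQUENCE IS `−respStepBmSeq`** (leaf-01's `RespStepBm.rowM_coDressKBmAt_KStepUnit`, levelwise). -/
theorem rowM_coDress_seq (ρ : Fin (d + 1) → ℤ) :
    (fun j => rowM (coDressKBmAt ρ Lc (KStepUnit (d := d) Lc j)) Lc) = fun j => -respStepBmSeq (d := d) ρ Lc j := by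
  funext j
  rw [rowM_coDressKBmAt_KStepUnit, respStepBmSeq_apply]

/-- [folklore] THE DRESSED CHAINS: `legChain (j ↦ colH Ĝ_j Lc) m k = legChain (respStepBmSeq ρ Lc) m k`. -/
theorem legChain_colH_coDress (ρ : Fin (d + 1) → ℤ) (m k : ℕ) :
    legChain (fun j => colH (coDressKBmAt ρ Lc (KStepUnit (d := d) Lc j)) Lc) m k = legChain (respStepBmSeq (d := d) ρ Lc) m k := by
  rw [colH_coDress_seq]

/-- [folklore] THE DRESSED ROW CHAINS: `legChain (j ↦ rowM Ĝ_j Lc) m k = (−1)^{k+1} • legChain (respStepBmSeq ρ Lc) m k`. -/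
theorem legChain_rowM_coDress (ρ : Fin (d + 1) → ℤ) (m k : ℕ) :
    legChain (fun j => rowM (coDressKBmAt ρ Lc (KStepUnit (d := d) Lc j)) Lc) m k
      = (-1 : ℝ) ^ (k + 1) • legChain (respStepBmSeq (d := d) ρ Lc) m k := by
  rw [rowM_coDress_seq, legChain_neg]

/-- [folklore] THE UNDRESSED ROW CHAINS: `legChain (j ↦ rowM K̃_j Lc) m k = (−1)^{k+1} • respStep (Lc^m) (Lc^(m+k+1))` (leaf-12's `rowM_KStepUnit_eq` = `−colH`, §2, leaf-10's
`legChain_colH`). -/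
theorem legChain_rowM_KStepUnit (m k : ℕ) :
    legChain (fun j => rowM (KStepUnit (d := d) Lc j) Lc) m k = (-1 : ℝ) ^ (k + 1) • respStep (d := d) (Lc ^ m) (Lc ^ (m + k + 1)) := by
  have e : (fun j => rowM (KStepUnit (d := d) Lc j) Lc) = fun j => -colH (KStepUnit (d := d) Lc j) Lc := by
    funext j; rw [rowM_KStepUnit_eq, colH_KStepUnit]
  rw [e, legChain_neg, legChain_colH]

end Comb

/-! ## §4 THE INSTANCE: `[P^E − P^B](m, k+1)` at the comb data is one symmetrised sum of four one-gauge-leg pushes -/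

section Instance

variable {Lc : ℕ} [NeZero Lc]

/-- NOT IN PRINT; OUR BOOKKEEPING ([folklore] composition BY NAME).  **THE COMB INSTANCE OF THE LEG-WISE TELESCOPE.**  Generic `d`; `K̃_j = KStepUnit Lc j` decaying at some positive rate
for every `j` (the K-slot's `UnitDecayK` gives one rate for all `j`); in-block root `ρ = toSite rr`; `Ĝ_j = coDressKBmAt ρ Lc K̃_j` (= `unitK_j (coDressKBmAt ρ Lc (KInvStep Lc j))`, asym1's
`unitK_coDressKBmAt`); `Y` ff-valued and `LocStencil₂` at a positive rate; any scalar `c` (for the literal `c = cE₂·Lc^{2(d+1)}`).  With the DRESSED column chain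
`R := legChain (respStepBmSeq ρ Lc) m k`, the UNDRESSED one `B := respStep (Lc^m) (Lc^(m+k+1))`, their difference — CT-2's PURE GAUGE — `G := (μ z κ u ↦ dz (λ_{m,k} μ z) κ u)`,
`λ_{m,k} μ z = Psi ρ Lc m k (delta1 μ z) − bmGaugeAt ρ (B μ z) Lc`, and the row sign `ε = (−1)^{k+1}`:
`transport (j ↦ lin4 c Ĝ_j Lc) m (k+1) Y − transport (j ↦ lin4 c K̃_j Lc) m (k+1) Y
   = (−c)^{k+1} • symB (push₄W (ε • G) R R R Y + push₄W (ε • B) G R R Y + push₄W (ε • B) B G R Y + push₄W (ε • B) B B G Y)`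
— each of the four pushes has EXACTLY ONE pure-gauge leg; the other three legs are full composite response families (dressed `R` ∕ undressed `B`). -/
theorem transport_lin4_coDress_sub_eq (hK : ∀ j, ∃ C m : ℝ, 0 < m ∧ Decays (KStepUnit (d := d) Lc j) C m)
    {rr : Fin (d + 1) → ℕ} (hrr : rr ∈ box (d + 1) Lc) (c : ℝ) (m k : ℕ) {Y : BiTab d}
    (hY : (∀ κ u κ' u', IsFF (Y κ u κ' u')) ∧ ∃ C δ : ℝ, 0 < δ ∧ LocStencil₂ Y C δ) :
    transport (fun j => lin4 c (coDressKBmAt (toSite rr) Lc (KStepUnit (d := d) Lc j)) Lc) m (k + 1) Y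
        - transport (fun j => lin4 c (KStepUnit (d := d) Lc j) Lc) m (k + 1) Y
      = (-c) ^ (k + 1) • symB (fun μ y ν y' =>
          push₄W ((-1 : ℝ) ^ (k + 1) • fun μ z κ u => dz (Psi (toSite rr) Lc m k (delta1 μ z)
              - bmGaugeAt (toSite rr) (respStep (d := d) (Lc ^ m) (Lc ^ (m + k + 1)) μ z) Lc) κ u)
            (legChain (respStepBmSeq (d := d) (toSite rr) Lc) m k) (legChain (respStepBmSeq (d := d) (toSite rr) Lc) m k)
            (legChain (respStepBmSeq (d := d) (toSite rr) Lc) m k) Y μ y ν y'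
          + push₄W ((-1 : ℝ) ^ (k + 1) • respStep (d := d) (Lc ^ m) (Lc ^ (m + k + 1)))
            (fun μ z κ u => dz (Psi (toSite rr) Lc m k (delta1 μ z)
              - bmGaugeAt (toSite rr) (respStep (d := d) (Lc ^ m) (Lc ^ (m + k + 1)) μ z) Lc) κ u)
            (legChain (respStepBmSeq (d := d) (toSite rr) Lc) m k) (legChain (respStepBmSeq (d := d) (toSite rr) Lc) m k) Y μ y ν y'
          + push₄W ((-1 : ℝ) ^ (k + 1) • respStep (d := d) (Lc ^ m) (Lc ^ (m + k + 1))) (respStep (d := d) (Lc ^ m) (Lc ^ (m + k + 1)))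
            (fun μ z κ u => dz (Psi (toSite rr) Lc m k (delta1 μ z)
              - bmGaugeAt (toSite rr) (respStep (d := d) (Lc ^ m) (Lc ^ (m + k + 1)) μ z) Lc) κ u)
            (legChain (respStepBmSeq (d := d) (toSite rr) Lc) m k) Y μ y ν y'
          + push₄W ((-1 : ℝ) ^ (k + 1) • respStep (d := d) (Lc ^ m) (Lc ^ (m + k + 1))) (respStep (d := d) (Lc ^ m) (Lc ^ (m + k + 1)))
            (respStep (d := d) (Lc ^ m) (Lc ^ (m + k + 1)))
            (fun μ z κ u => dz (Psi (toSite rr) Lc m k (delta1 μ z)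
              - bmGaugeAt (toSite rr) (respStep (d := d) (Lc ^ m) (Lc ^ (m + k + 1)) μ z) Lc) κ u) Y μ y ν y') := by
  have hLc : 1 ≤ Lc := Nat.one_le_iff_ne_zero.2 (NeZero.ne Lc)
  -- the dressed kernels decay at positive rates
  have hG : ∀ j, ∃ C m : ℝ, 0 < m ∧ Decays (coDressKBmAt (toSite rr) Lc (KStepUnit (d := d) Lc j)) C m := fun j => by
    obtain ⟨C, m, hm, hKj⟩ := hK j
    obtain ⟨δ, C', hδ, -, h⟩ := decays_coDressKBmAt hLc hrr ⟨m, C, hm, hKj.nonneg (Sum.inl 0), hKj⟩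
    exact ⟨C', δ, hδ, h⟩
  -- the four leg sequences are localised at positive rates
  obtain ⟨hlE, hrE, -, -⟩ := legDecay_literal_legs (d := d) hLc hrr hK
  have hlB : ∀ j, ∃ C m : ℝ, 0 < m ∧ LegDecay (rowM (KStepUnit (d := d) Lc j) Lc) Lc C m := fun j => by
    obtain ⟨C, m, hm, hKj⟩ := hK j; exact ⟨C, m, hm, legDecay_rowM hKj⟩
  have hrB : ∀ j, ∃ C m : ℝ, 0 < m ∧ LegDecay (colH (KStepUnit (d := d) Lc j) Lc) Lc C m := fun j => by
    obtain ⟨C, m, hm, hKj⟩ := hK j; exact ⟨C, m, hm, legDecay_colH hKj⟩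
  obtain ⟨CY, δY, hδY, hYl⟩ := hY.2
  -- both transports in symmetrised-push form, the leg-wise telescope through the chains, the comb dictionary, and CT-2's pure gauge
  rw [transport_lin4_eq_smul_transport_symB hLc hG c m (k + 1) hY, transport_lin4_eq_smul_transport_symB hLc hK c m (k + 1) hY, ← smul_sub,
    Push4LegTelescope.transport_symPush_sub hLc hlE hrE hlB hrB hYl hδY m k,
    legChain_rowM_coDress, legChain_colH_coDress, legChain_rowM_KStepUnit, legChain_colH, ← smul_sub,
    legChain_respStepBmSeq_sub_respStep hrr m k]

end Instance

end Summit.QuantumFields.BalabanUV.Beta.GAN24.Push4LegTelescopeComb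

end
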